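import Summits.HodgeConjecture.CorCM.IrreducibleOddWeightsIsotypicSplittingDefect
import HarnessLib

/-!
# Isotypic cells, XI: THE MEET SPLITS OVER ALL ISOTYPIC CLASSES AT ONCE —
# `S(Σ_c p⁰_c) ∩ S(Σ_c p¹_c) = ⨁_c (S(p⁰_c) ∩ S(p¹_c))` and the defect is `Σ_c dim(S(p⁰_c) ∩ S(p¹_c))`

COR-CM (cell `pub-hodgecm2`, binder seat `b16` gen 70, count-neutral claim ISOTYPIC SPLITTING OF THE DEFECT, file I11 —
abstract `G`-set level and type ranks; theorems only, no definition, no named fact, no `sorry`).  NEW as stated, hence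
under `Summits/`.  HONEST FRAMING: linear algebra of translates of functions on finite `G`-sets (files I1–I6); the
consequence for the Kubota–Dodson rank of a pair of CM types is the last section; nothing about Hodge classes is
asserted.

SETTING.  `G` acts on finite `Y₀, Y₁`; `S(w) = span{g ↦ w(g·y)} ≤ ℚ^G`.  On each pivot a finite family of stable
irreducible constituents `A⁰_j ≤ ℚ^{Y₀}` (`j ∈ J₀`), `A¹_j ≤ ℚ^{Y₁}` (`j ∈ J₁`), each carrying a CLASS LABEL
`c₀ j`, `c₁ j` in a set `C` such that NO non-zero constituent EMBEDS equivariantly into a constituent WITH A DIFFERENT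
LABEL (on the same or on the other pivot) — e.g. the labels are the isomorphism classes.  CLASS COMPONENTS: vectors
`p⁰_c ∈ Σ_{c₀ j = c} A⁰_j`, `p¹_c ∈ Σ_{c₁ j = c} A¹_j`.

* §1 `exists_classComponents_of_mem_iSup`: every `w ∈ Σ_j A_j` is a sum `w = Σ_c p_c` of class components.
* §2 **THE MEET SPLITS OVER THE CLASSES** (`span_shadowCoeff_sum_inf_eq_finsetSup_of_classes`,
  `span_shadowCoeff_sum_inf_eq_iSup_of_classes`): **`S(Σ_c p⁰_c) ∩ S(Σ_c p¹_c) = ⨆_c (S(p⁰_c) ∩ S(p¹_c))`**, and the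
  dimensions ADD (`finrank_span_shadowCoeff_sum_inf_eq_sum_of_classes{_finset}`):
  **`dim(S(w₀) ∩ S(w₁)) = Σ_c dim(S(p⁰_c) ∩ S(p¹_c))`** — file I4's binary cut iterated along a finite set of classes.
* §3 TYPE RANKS (`typeRank_add_typeRank_eq_add_sum_of_classes`, `exists_typeRank_add_typeRank_eq_add_sum_of_classes`):
  two slots with equivariant pivots refining the trace classes, shadows `w_κ` in `Σ_j A^κ_j` ⟹
  **`rank Φ₀ + rank Φ₁ = rank(Φ₀,Φ₁) + 1 + Σ_c dim(S(p⁰_c) ∩ S(p¹_c))`**: the defect is the SUM OF THE CLASS DEFECTS;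
  a class met by one side only contributes `0`; a class of dimension-`d` constituents contributes a multiple of `d`
  (file I5); an absolutely irreducible class contributes `(rank b + rank b′ − rank(b ⊔ b′))·d` (files I9/I10).

## References

* [Serre1977] J.-P. Serre, *Linear Representations of Finite Groups*, GTM 42, §2.6 (canonical decomposition).
* [Lang2002] S. Lang, *Algebra*, 3rd ed., XVII §2, XVII §3.
* [Gordon1999HodgeAVSurvey] B. B. Gordon, *A survey of the Hodge conjecture for abelian varieties*, §3 Theorem (proof),
  7.5–7.7, 9.4.3.
-/

set_option autoImplicit false

noncomputable section

open scoped BigOperators Classical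

universe u u' u₀ u₁ v v' v'' w

namespace Summit.HodgeConjecture.CorCM.IrrOdd

open Literature.NumberTheory.ComplexMultiplication

variable {G : Type w} [Group G] {Y₀ : Type v'} [MulAction G Y₀] [Fintype Y₀]
  {Y₁ : Type v''} [MulAction G Y₁] [Fintype Y₁]

/-! ### §1 Class components -/

omit [Fintype Y₀] in
/-- **CLASS COMPONENTS EXIST**: a vector of `Σ_j A_j` is a sum `Σ_c p_c` with `p_c ∈ Σ_{c j = c} A_j` (group a
decomposition along the constituents by class label). [cite: Serre1977, §2.6] -/
theorem exists_classComponents_of_mem_iSup {C : Type u} [Fintype C] {J : Type u'} [Fintype J] (cl : J → C)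
    {A : J → Submodule ℚ (Y₀ → ℚ)} {w : Y₀ → ℚ} (hw : w ∈ ⨆ j, A j) :
    ∃ p : C → (Y₀ → ℚ), (∀ c, p c ∈ ⨆ j : {j // cl j = c}, A j.1) ∧ ∑ c, p c = w := by
  obtain ⟨f, hf, hfw⟩ := (Submodule.mem_iSup_iff_exists_finsupp A w).1 hw
  refine ⟨fun c => ∑ j ∈ Finset.univ.filter (fun j => cl j = c), f j, fun c => ?_, ?_⟩
  · refine Submodule.sum_mem _ fun j hj => ?_
    have hjc : cl j = c := (Finset.mem_filter.1 hj).2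
    exact Submodule.mem_iSup_of_mem (p := fun j' : {j' // cl j' = c} => A j'.1) ⟨j, hjc⟩ (hf j)
  · show ∑ c, ∑ j ∈ Finset.univ.filter (fun j => cl j = c), f j = w
    rw [Finset.sum_fiberwise Finset.univ cl (fun j => (f j : Y₀ → ℚ)), ← hfw,
      Finsupp.sum_fintype _ _ (fun _ => rfl)]

/-! ### §2 The meet splits over all classes -/

/-- **THE MEET SPLITS OVER THE CLASSES (finite-set form)**: for class components `p⁰_c`, `p¹_c` and a finite set `s`
of labels, `S(Σ_{c∈s} p⁰_c) ∩ S(Σ_{c∈s} p¹_c) = sup_{c∈s} (S(p⁰_c) ∩ S(p¹_c))` — induction on `s` by the binary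
cut of file I4 (class `c` against the classes of `s`). [cite: Serre1977, §2.6] [cite: Lang2002, XVII §3]
[cite: Gordon1999HodgeAVSurvey, §3 Theorem (proof), 7.5–7.7] -/
theorem span_shadowCoeff_sum_inf_eq_finsetSup_of_classes {C : Type u} {J₀ : Type u₀} {J₁ : Type u₁}
    [Fintype J₀] [Fintype J₁] (c₀ : J₀ → C) (c₁ : J₁ → C)
    {A₀ : J₀ → Submodule ℚ (Y₀ → ℚ)} {A₁ : J₁ → Submodule ℚ (Y₁ → ℚ)}
    (hA₀st : ∀ (j : J₀) (k : G) (a : Y₀ → ℚ), a ∈ A₀ j → (fun y => a (k • y)) ∈ A₀ j)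
    (hA₀irr : ∀ (j : J₀) (W : Submodule ℚ (Y₀ → ℚ)), W ≤ A₀ j → W ≠ ⊥ →
      (∀ (k : G) (f : Y₀ → ℚ), f ∈ W → (fun y => f (k • y)) ∈ W) → W = A₀ j)
    (hA₁st : ∀ (j : J₁) (k : G) (a : Y₁ → ℚ), a ∈ A₁ j → (fun y => a (k • y)) ∈ A₁ j)
    (hA₁irr : ∀ (j : J₁) (W : Submodule ℚ (Y₁ → ℚ)), W ≤ A₁ j → W ≠ ⊥ →
      (∀ (k : G) (f : Y₁ → ℚ), f ∈ W → (fun y => f (k • y)) ∈ W) → W = A₁ j)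
    (h₀₀ : ∀ (j k : J₀) (L : (Y₀ → ℚ) →ₗ[ℚ] (Y₀ → ℚ)), c₀ j ≠ c₀ k → A₀ j ≠ ⊥ → (∀ a ∈ A₀ j, L a ∈ A₀ k) →
      (∀ a ∈ A₀ j, L a = 0 → a = 0) → (∀ (g : G) (a : Y₀ → ℚ), a ∈ A₀ j →
        L (fun y => a (g • y)) = fun y => L a (g • y)) → False)
    (h₀₁ : ∀ (j : J₀) (k : J₁) (L : (Y₀ → ℚ) →ₗ[ℚ] (Y₁ → ℚ)), c₀ j ≠ c₁ k → A₀ j ≠ ⊥ → (∀ a ∈ A₀ j, L a ∈ A₁ k) →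
      (∀ a ∈ A₀ j, L a = 0 → a = 0) → (∀ (g : G) (a : Y₀ → ℚ), a ∈ A₀ j →
        L (fun y => a (g • y)) = fun y => L a (g • y)) → False)
    (h₁₀ : ∀ (j : J₁) (k : J₀) (L : (Y₁ → ℚ) →ₗ[ℚ] (Y₀ → ℚ)), c₁ j ≠ c₀ k → A₁ j ≠ ⊥ → (∀ a ∈ A₁ j, L a ∈ A₀ k) →
      (∀ a ∈ A₁ j, L a = 0 → a = 0) → (∀ (g : G) (a : Y₁ → ℚ), a ∈ A₁ j →
        L (fun y => a (g • y)) = fun y => L a (g • y)) → False)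
    (h₁₁ : ∀ (j k : J₁) (L : (Y₁ → ℚ) →ₗ[ℚ] (Y₁ → ℚ)), c₁ j ≠ c₁ k → A₁ j ≠ ⊥ → (∀ a ∈ A₁ j, L a ∈ A₁ k) →
      (∀ a ∈ A₁ j, L a = 0 → a = 0) → (∀ (g : G) (a : Y₁ → ℚ), a ∈ A₁ j →
        L (fun y => a (g • y)) = fun y => L a (g • y)) → False)
    {p₀ : C → (Y₀ → ℚ)} {p₁ : C → (Y₁ → ℚ)}
    (hp₀ : ∀ c, p₀ c ∈ ⨆ j : {j // c₀ j = c}, A₀ j.1) (hp₁ : ∀ c, p₁ c ∈ ⨆ j : {j // c₁ j = c}, A₁ j.1)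
    (s : Finset C) :
    Submodule.span ℚ (Set.range fun y : Y₀ => fun g : G => (∑ c ∈ s, p₀ c) (g • y)) ⊓
        Submodule.span ℚ (Set.range fun y : Y₁ => fun g : G => (∑ c ∈ s, p₁ c) (g • y)) =
      s.sup fun c => Submodule.span ℚ (Set.range fun y : Y₀ => fun g : G => p₀ c (g • y)) ⊓
        Submodule.span ℚ (Set.range fun y : Y₁ => fun g : G => p₁ c (g • y)) := by
  refine Finset.induction_on s ?_ ?_
  · rw [Finset.sum_empty, Finset.sum_empty, Finset.sup_empty,
      (span_shadowCoeff_eq_bot_iff (G := G) (0 : Y₀ → ℚ)).2 rfl, bot_inf_eq]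
  intro c s hc ih
  rw [Finset.sum_insert hc, Finset.sum_insert hc, Finset.sup_insert, ← ih]
  -- the tail sums lie in the constituents labelled in `s`
  have hq₀ : (∑ c' ∈ s, p₀ c') ∈ ⨆ j : {j // c₀ j ∈ s}, A₀ j.1 := by
    refine Submodule.sum_mem _ fun c' hc' => ?_
    have hle : (⨆ j : {j // c₀ j = c'}, A₀ j.1) ≤ ⨆ j : {j // c₀ j ∈ s}, A₀ j.1 :=
      iSup_le fun j => le_iSup (fun j : {j // c₀ j ∈ s} => A₀ j.1) ⟨j.1, by rw [j.2]; exact hc'⟩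
    exact hle (hp₀ c')
  have hq₁ : (∑ c' ∈ s, p₁ c') ∈ ⨆ j : {j // c₁ j ∈ s}, A₁ j.1 := by
    refine Submodule.sum_mem _ fun c' hc' => ?_
    have hle : (⨆ j : {j // c₁ j = c'}, A₁ j.1) ≤ ⨆ j : {j // c₁ j ∈ s}, A₁ j.1 :=
      iSup_le fun j => le_iSup (fun j : {j // c₁ j ∈ s} => A₁ j.1) ⟨j.1, by rw [j.2]; exact hc'⟩
    exact hle (hp₁ c')
  -- labels: `c ∉ s`, so class `c` and the classes of `s` never share a label
  have hne₀₀ : ∀ (j : {j // c₀ j = c}) (k : {k // c₀ k ∈ s}), c₀ j.1 ≠ c₀ k.1 := fun j k h =>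
    hc (by rw [← j.2, h]; exact k.2)
  have hne₀₁ : ∀ (j : {j // c₀ j = c}) (k : {k // c₁ k ∈ s}), c₀ j.1 ≠ c₁ k.1 := fun j k h =>
    hc (by rw [← j.2, h]; exact k.2)
  have hne₁₀ : ∀ (j : {j // c₁ j = c}) (k : {k // c₀ k ∈ s}), c₁ j.1 ≠ c₀ k.1 := fun j k h =>
    hc (by rw [← j.2, h]; exact k.2)
  have hne₁₁ : ∀ (j : {j // c₁ j = c}) (k : {k // c₁ k ∈ s}), c₁ j.1 ≠ c₁ k.1 := fun j k h =>
    hc (by rw [← j.2, h]; exact k.2)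
  exact span_shadowCoeff_inf_eq_sup_of_cut (A₀ := fun j : {j // c₀ j = c} => A₀ j.1)
    (A₁ := fun j : {j // c₁ j = c} => A₁ j.1) (B₀ := fun j : {j // c₀ j ∈ s} => A₀ j.1)
    (B₁ := fun j : {j // c₁ j ∈ s} => A₁ j.1)
    (fun j k a ha => hA₀st j.1 k a ha) (fun j W hW hW0 hWst => hA₀irr j.1 W hW hW0 hWst)
    (fun j k a ha => hA₁st j.1 k a ha) (fun j W hW hW0 hWst => hA₁irr j.1 W hW hW0 hWst)
    (fun j k a ha => hA₀st j.1 k a ha) (fun j W hW hW0 hWst => hA₀irr j.1 W hW hW0 hWst)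
    (fun j k a ha => hA₁st j.1 k a ha) (fun j W hW hW0 hWst => hA₁irr j.1 W hW hW0 hWst)
    (fun j k L => h₀₀ j.1 k.1 L (hne₀₀ j k)) (fun j k L => h₀₁ j.1 k.1 L (hne₀₁ j k))
    (fun j k L => h₁₀ j.1 k.1 L (hne₁₀ j k)) (fun j k L => h₁₁ j.1 k.1 L (hne₁₁ j k))
    (hp₀ c) hq₀ (hp₁ c) hq₁

/-- **THE MEET SPLITS OVER ALL CLASSES**: `S(Σ_c p⁰_c) ∩ S(Σ_c p¹_c) = ⨆_c (S(p⁰_c) ∩ S(p¹_c))` for class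
components over a finite label set. [cite: Serre1977, §2.6] [cite: Lang2002, XVII §3]
[cite: Gordon1999HodgeAVSurvey, §3 Theorem (proof), 7.5–7.7] -/
theorem span_shadowCoeff_sum_inf_eq_iSup_of_classes {C : Type u} [Fintype C] {J₀ : Type u₀} {J₁ : Type u₁}
    [Fintype J₀] [Fintype J₁] (c₀ : J₀ → C) (c₁ : J₁ → C)
    {A₀ : J₀ → Submodule ℚ (Y₀ → ℚ)} {A₁ : J₁ → Submodule ℚ (Y₁ → ℚ)}
    (hA₀st : ∀ (j : J₀) (k : G) (a : Y₀ → ℚ), a ∈ A₀ j → (fun y => a (k • y)) ∈ A₀ j)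
    (hA₀irr : ∀ (j : J₀) (W : Submodule ℚ (Y₀ → ℚ)), W ≤ A₀ j → W ≠ ⊥ →
      (∀ (k : G) (f : Y₀ → ℚ), f ∈ W → (fun y => f (k • y)) ∈ W) → W = A₀ j)
    (hA₁st : ∀ (j : J₁) (k : G) (a : Y₁ → ℚ), a ∈ A₁ j → (fun y => a (k • y)) ∈ A₁ j)
    (hA₁irr : ∀ (j : J₁) (W : Submodule ℚ (Y₁ → ℚ)), W ≤ A₁ j → W ≠ ⊥ →
      (∀ (k : G) (f : Y₁ → ℚ), f ∈ W → (fun y => f (k • y)) ∈ W) → W = A₁ j)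
    (h₀₀ : ∀ (j k : J₀) (L : (Y₀ → ℚ) →ₗ[ℚ] (Y₀ → ℚ)), c₀ j ≠ c₀ k → A₀ j ≠ ⊥ → (∀ a ∈ A₀ j, L a ∈ A₀ k) →
      (∀ a ∈ A₀ j, L a = 0 → a = 0) → (∀ (g : G) (a : Y₀ → ℚ), a ∈ A₀ j →
        L (fun y => a (g • y)) = fun y => L a (g • y)) → False)
    (h₀₁ : ∀ (j : J₀) (k : J₁) (L : (Y₀ → ℚ) →ₗ[ℚ] (Y₁ → ℚ)), c₀ j ≠ c₁ k → A₀ j ≠ ⊥ → (∀ a ∈ A₀ j, L a ∈ A₁ k) →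
      (∀ a ∈ A₀ j, L a = 0 → a = 0) → (∀ (g : G) (a : Y₀ → ℚ), a ∈ A₀ j →
        L (fun y => a (g • y)) = fun y => L a (g • y)) → False)
    (h₁₀ : ∀ (j : J₁) (k : J₀) (L : (Y₁ → ℚ) →ₗ[ℚ] (Y₀ → ℚ)), c₁ j ≠ c₀ k → A₁ j ≠ ⊥ → (∀ a ∈ A₁ j, L a ∈ A₀ k) →
      (∀ a ∈ A₁ j, L a = 0 → a = 0) → (∀ (g : G) (a : Y₁ → ℚ), a ∈ A₁ j →
        L (fun y => a (g • y)) = fun y => L a (g • y)) → False)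
    (h₁₁ : ∀ (j k : J₁) (L : (Y₁ → ℚ) →ₗ[ℚ] (Y₁ → ℚ)), c₁ j ≠ c₁ k → A₁ j ≠ ⊥ → (∀ a ∈ A₁ j, L a ∈ A₁ k) →
      (∀ a ∈ A₁ j, L a = 0 → a = 0) → (∀ (g : G) (a : Y₁ → ℚ), a ∈ A₁ j →
        L (fun y => a (g • y)) = fun y => L a (g • y)) → False)
    {p₀ : C → (Y₀ → ℚ)} {p₁ : C → (Y₁ → ℚ)}
    (hp₀ : ∀ c, p₀ c ∈ ⨆ j : {j // c₀ j = c}, A₀ j.1) (hp₁ : ∀ c, p₁ c ∈ ⨆ j : {j // c₁ j = c}, A₁ j.1) :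
    Submodule.span ℚ (Set.range fun y : Y₀ => fun g : G => (∑ c, p₀ c) (g • y)) ⊓
        Submodule.span ℚ (Set.range fun y : Y₁ => fun g : G => (∑ c, p₁ c) (g • y)) =
      ⨆ c, Submodule.span ℚ (Set.range fun y : Y₀ => fun g : G => p₀ c (g • y)) ⊓
        Submodule.span ℚ (Set.range fun y : Y₁ => fun g : G => p₁ c (g • y)) := by
  rw [← Finset.sup_univ_eq_iSup]
  exact span_shadowCoeff_sum_inf_eq_finsetSup_of_classes c₀ c₁ hA₀st hA₀irr hA₁st hA₁irr h₀₀ h₀₁ h₁₀ h₁₁ hp₀ hp₁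
    Finset.univ

/-- **THE DIMENSIONS ADD (finite-set form)**: `dim(S(Σ_{c∈s} p⁰_c) ∩ S(Σ_{c∈s} p¹_c)) = Σ_{c∈s} dim(S(p⁰_c) ∩ S(p¹_c))`.
[cite: Serre1977, §2.6] [cite: Gordon1999HodgeAVSurvey, §3 Theorem (proof), 7.5–7.7] -/
theorem finrank_span_shadowCoeff_sum_inf_eq_sum_of_classes_finset {C : Type u} {J₀ : Type u₀} {J₁ : Type u₁}
    [Fintype J₀] [Fintype J₁] (c₀ : J₀ → C) (c₁ : J₁ → C)
    {A₀ : J₀ → Submodule ℚ (Y₀ → ℚ)} {A₁ : J₁ → Submodule ℚ (Y₁ → ℚ)}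
    (hA₀st : ∀ (j : J₀) (k : G) (a : Y₀ → ℚ), a ∈ A₀ j → (fun y => a (k • y)) ∈ A₀ j)
    (hA₀irr : ∀ (j : J₀) (W : Submodule ℚ (Y₀ → ℚ)), W ≤ A₀ j → W ≠ ⊥ →
      (∀ (k : G) (f : Y₀ → ℚ), f ∈ W → (fun y => f (k • y)) ∈ W) → W = A₀ j)
    (hA₁st : ∀ (j : J₁) (k : G) (a : Y₁ → ℚ), a ∈ A₁ j → (fun y => a (k • y)) ∈ A₁ j)
    (hA₁irr : ∀ (j : J₁) (W : Submodule ℚ (Y₁ → ℚ)), W ≤ A₁ j → W ≠ ⊥ →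
      (∀ (k : G) (f : Y₁ → ℚ), f ∈ W → (fun y => f (k • y)) ∈ W) → W = A₁ j)
    (h₀₀ : ∀ (j k : J₀) (L : (Y₀ → ℚ) →ₗ[ℚ] (Y₀ → ℚ)), c₀ j ≠ c₀ k → A₀ j ≠ ⊥ → (∀ a ∈ A₀ j, L a ∈ A₀ k) →
      (∀ a ∈ A₀ j, L a = 0 → a = 0) → (∀ (g : G) (a : Y₀ → ℚ), a ∈ A₀ j →
        L (fun y => a (g • y)) = fun y => L a (g • y)) → False)
    (h₀₁ : ∀ (j : J₀) (k : J₁) (L : (Y₀ → ℚ) →ₗ[ℚ] (Y₁ → ℚ)), c₀ j ≠ c₁ k → A₀ j ≠ ⊥ → (∀ a ∈ A₀ j, L a ∈ A₁ k) →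
      (∀ a ∈ A₀ j, L a = 0 → a = 0) → (∀ (g : G) (a : Y₀ → ℚ), a ∈ A₀ j →
        L (fun y => a (g • y)) = fun y => L a (g • y)) → False)
    (h₁₀ : ∀ (j : J₁) (k : J₀) (L : (Y₁ → ℚ) →ₗ[ℚ] (Y₀ → ℚ)), c₁ j ≠ c₀ k → A₁ j ≠ ⊥ → (∀ a ∈ A₁ j, L a ∈ A₀ k) →
      (∀ a ∈ A₁ j, L a = 0 → a = 0) → (∀ (g : G) (a : Y₁ → ℚ), a ∈ A₁ j →
        L (fun y => a (g • y)) = fun y => L a (g • y)) → False)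
    (h₁₁ : ∀ (j k : J₁) (L : (Y₁ → ℚ) →ₗ[ℚ] (Y₁ → ℚ)), c₁ j ≠ c₁ k → A₁ j ≠ ⊥ → (∀ a ∈ A₁ j, L a ∈ A₁ k) →
      (∀ a ∈ A₁ j, L a = 0 → a = 0) → (∀ (g : G) (a : Y₁ → ℚ), a ∈ A₁ j →
        L (fun y => a (g • y)) = fun y => L a (g • y)) → False)
    {p₀ : C → (Y₀ → ℚ)} {p₁ : C → (Y₁ → ℚ)}
    (hp₀ : ∀ c, p₀ c ∈ ⨆ j : {j // c₀ j = c}, A₀ j.1) (hp₁ : ∀ c, p₁ c ∈ ⨆ j : {j // c₁ j = c}, A₁ j.1)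
    (s : Finset C) :
    Module.finrank ℚ ↥(Submodule.span ℚ (Set.range fun y : Y₀ => fun g : G => (∑ c ∈ s, p₀ c) (g • y)) ⊓
        Submodule.span ℚ (Set.range fun y : Y₁ => fun g : G => (∑ c ∈ s, p₁ c) (g • y))) =
      ∑ c ∈ s, Module.finrank ℚ ↥(Submodule.span ℚ (Set.range fun y : Y₀ => fun g : G => p₀ c (g • y)) ⊓
        Submodule.span ℚ (Set.range fun y : Y₁ => fun g : G => p₁ c (g • y))) := by
  refine Finset.induction_on s ?_ ?_
  · rw [Finset.sum_empty, Finset.sum_empty, Finset.sum_empty,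
      (span_shadowCoeff_eq_bot_iff (G := G) (0 : Y₀ → ℚ)).2 rfl, bot_inf_eq, finrank_bot]
  intro c s hc ih
  rw [Finset.sum_insert hc, Finset.sum_insert hc, Finset.sum_insert hc, ← ih]
  have hq₀ : (∑ c' ∈ s, p₀ c') ∈ ⨆ j : {j // c₀ j ∈ s}, A₀ j.1 := by
    refine Submodule.sum_mem _ fun c' hc' => ?_
    have hle : (⨆ j : {j // c₀ j = c'}, A₀ j.1) ≤ ⨆ j : {j // c₀ j ∈ s}, A₀ j.1 :=
      iSup_le fun j => le_iSup (fun j : {j // c₀ j ∈ s} => A₀ j.1) ⟨j.1, by rw [j.2]; exact hc'⟩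
    exact hle (hp₀ c')
  have hq₁ : (∑ c' ∈ s, p₁ c') ∈ ⨆ j : {j // c₁ j ∈ s}, A₁ j.1 := by
    refine Submodule.sum_mem _ fun c' hc' => ?_
    have hle : (⨆ j : {j // c₁ j = c'}, A₁ j.1) ≤ ⨆ j : {j // c₁ j ∈ s}, A₁ j.1 :=
      iSup_le fun j => le_iSup (fun j : {j // c₁ j ∈ s} => A₁ j.1) ⟨j.1, by rw [j.2]; exact hc'⟩
    exact hle (hp₁ c')
  have hne₀₀ : ∀ (j : {j // c₀ j = c}) (k : {k // c₀ k ∈ s}), c₀ j.1 ≠ c₀ k.1 := fun j k h =>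
    hc (by rw [← j.2, h]; exact k.2)
  have hne₀₁ : ∀ (j : {j // c₀ j = c}) (k : {k // c₁ k ∈ s}), c₀ j.1 ≠ c₁ k.1 := fun j k h =>
    hc (by rw [← j.2, h]; exact k.2)
  have hne₁₀ : ∀ (j : {j // c₁ j = c}) (k : {k // c₀ k ∈ s}), c₁ j.1 ≠ c₀ k.1 := fun j k h =>
    hc (by rw [← j.2, h]; exact k.2)
  have hne₁₁ : ∀ (j : {j // c₁ j = c}) (k : {k // c₁ k ∈ s}), c₁ j.1 ≠ c₁ k.1 := fun j k h =>
    hc (by rw [← j.2, h]; exact k.2)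
  exact finrank_span_shadowCoeff_inf_eq_add_of_cut (A₀ := fun j : {j // c₀ j = c} => A₀ j.1)
    (A₁ := fun j : {j // c₁ j = c} => A₁ j.1) (B₀ := fun j : {j // c₀ j ∈ s} => A₀ j.1)
    (B₁ := fun j : {j // c₁ j ∈ s} => A₁ j.1)
    (fun j k a ha => hA₀st j.1 k a ha) (fun j W hW hW0 hWst => hA₀irr j.1 W hW hW0 hWst)
    (fun j k a ha => hA₁st j.1 k a ha) (fun j W hW hW0 hWst => hA₁irr j.1 W hW hW0 hWst)
    (fun j k a ha => hA₀st j.1 k a ha) (fun j W hW hW0 hWst => hA₀irr j.1 W hW hW0 hWst)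
    (fun j k a ha => hA₁st j.1 k a ha) (fun j W hW hW0 hWst => hA₁irr j.1 W hW hW0 hWst)
    (fun j k L => h₀₀ j.1 k.1 L (hne₀₀ j k)) (fun j k L => h₀₁ j.1 k.1 L (hne₀₁ j k))
    (fun j k L => h₁₀ j.1 k.1 L (hne₁₀ j k)) (fun j k L => h₁₁ j.1 k.1 L (hne₁₁ j k))
    (hp₀ c) hq₀ (hp₁ c) hq₁

/-- **THE DEFECT IS THE SUM OF THE CLASS DEFECTS**: `dim(S(Σ_c p⁰_c) ∩ S(Σ_c p¹_c)) = Σ_c dim(S(p⁰_c) ∩ S(p¹_c))`.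
[cite: Serre1977, §2.6] [cite: Gordon1999HodgeAVSurvey, §3 Theorem (proof), 7.5–7.7] -/
theorem finrank_span_shadowCoeff_sum_inf_eq_sum_of_classes {C : Type u} [Fintype C] {J₀ : Type u₀} {J₁ : Type u₁}
    [Fintype J₀] [Fintype J₁] (c₀ : J₀ → C) (c₁ : J₁ → C)
    {A₀ : J₀ → Submodule ℚ (Y₀ → ℚ)} {A₁ : J₁ → Submodule ℚ (Y₁ → ℚ)}
    (hA₀st : ∀ (j : J₀) (k : G) (a : Y₀ → ℚ), a ∈ A₀ j → (fun y => a (k • y)) ∈ A₀ j)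
    (hA₀irr : ∀ (j : J₀) (W : Submodule ℚ (Y₀ → ℚ)), W ≤ A₀ j → W ≠ ⊥ →
      (∀ (k : G) (f : Y₀ → ℚ), f ∈ W → (fun y => f (k • y)) ∈ W) → W = A₀ j)
    (hA₁st : ∀ (j : J₁) (k : G) (a : Y₁ → ℚ), a ∈ A₁ j → (fun y => a (k • y)) ∈ A₁ j)
    (hA₁irr : ∀ (j : J₁) (W : Submodule ℚ (Y₁ → ℚ)), W ≤ A₁ j → W ≠ ⊥ →
      (∀ (k : G) (f : Y₁ → ℚ), f ∈ W → (fun y => f (k • y)) ∈ W) → W = A₁ j)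
    (h₀₀ : ∀ (j k : J₀) (L : (Y₀ → ℚ) →ₗ[ℚ] (Y₀ → ℚ)), c₀ j ≠ c₀ k → A₀ j ≠ ⊥ → (∀ a ∈ A₀ j, L a ∈ A₀ k) →
      (∀ a ∈ A₀ j, L a = 0 → a = 0) → (∀ (g : G) (a : Y₀ → ℚ), a ∈ A₀ j →
        L (fun y => a (g • y)) = fun y => L a (g • y)) → False)
    (h₀₁ : ∀ (j : J₀) (k : J₁) (L : (Y₀ → ℚ) →ₗ[ℚ] (Y₁ → ℚ)), c₀ j ≠ c₁ k → A₀ j ≠ ⊥ → (∀ a ∈ A₀ j, L a ∈ A₁ k) →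
      (∀ a ∈ A₀ j, L a = 0 → a = 0) → (∀ (g : G) (a : Y₀ → ℚ), a ∈ A₀ j →
        L (fun y => a (g • y)) = fun y => L a (g • y)) → False)
    (h₁₀ : ∀ (j : J₁) (k : J₀) (L : (Y₁ → ℚ) →ₗ[ℚ] (Y₀ → ℚ)), c₁ j ≠ c₀ k → A₁ j ≠ ⊥ → (∀ a ∈ A₁ j, L a ∈ A₀ k) →
      (∀ a ∈ A₁ j, L a = 0 → a = 0) → (∀ (g : G) (a : Y₁ → ℚ), a ∈ A₁ j →
        L (fun y => a (g • y)) = fun y => L a (g • y)) → False)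
    (h₁₁ : ∀ (j k : J₁) (L : (Y₁ → ℚ) →ₗ[ℚ] (Y₁ → ℚ)), c₁ j ≠ c₁ k → A₁ j ≠ ⊥ → (∀ a ∈ A₁ j, L a ∈ A₁ k) →
      (∀ a ∈ A₁ j, L a = 0 → a = 0) → (∀ (g : G) (a : Y₁ → ℚ), a ∈ A₁ j →
        L (fun y => a (g • y)) = fun y => L a (g • y)) → False)
    {p₀ : C → (Y₀ → ℚ)} {p₁ : C → (Y₁ → ℚ)}
    (hp₀ : ∀ c, p₀ c ∈ ⨆ j : {j // c₀ j = c}, A₀ j.1) (hp₁ : ∀ c, p₁ c ∈ ⨆ j : {j // c₁ j = c}, A₁ j.1) :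
    Module.finrank ℚ ↥(Submodule.span ℚ (Set.range fun y : Y₀ => fun g : G => (∑ c, p₀ c) (g • y)) ⊓
        Submodule.span ℚ (Set.range fun y : Y₁ => fun g : G => (∑ c, p₁ c) (g • y))) =
      ∑ c, Module.finrank ℚ ↥(Submodule.span ℚ (Set.range fun y : Y₀ => fun g : G => p₀ c (g • y)) ⊓
        Submodule.span ℚ (Set.range fun y : Y₁ => fun g : G => p₁ c (g • y))) :=
  finrank_span_shadowCoeff_sum_inf_eq_sum_of_classes_finset c₀ c₁ hA₀st hA₀irr hA₁st hA₁irr h₀₀ h₀₁ h₁₀ h₁₁ hp₀ hp₁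
    Finset.univ

/-! ### §3 Type ranks: the defect is the sum of the class defects -/

section TypeRanks

variable {I : Type u} {E : I → Type v} [∀ i, MulAction G (E i)] [∀ i, Fintype (E i)] [Fintype I] [∀ i, Nonempty (E i)]

/-- **THE DEFECT IS THE SUM OF THE CLASS DEFECTS (type ranks).**  Two slots with equivariant pivots
`r_κ : E_κ → Y_κ` refining the trace classes; the constituents of the shadow modules labelled by classes so that no
non-zero constituent embeds equivariantly into one with a different label; the shadows written as sums of class
components `w_κ = Σ_c p^κ_c`.  Then
**`rank Φ₀ + rank Φ₁ = rank(Φ₀,Φ₁) + 1 + Σ_c dim(S(p⁰_c) ∩ S(p¹_c))`**. [cite: Gordon1999HodgeAVSurvey, §3 Theorem,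
7.5–7.7 and 9.4.3] [cite: Serre1977, §2.6] -/
theorem typeRank_add_typeRank_eq_add_sum_of_classes {ρ : G} {Φ : ∀ i, Set (E i)}
    (h : ∀ i, IsCMTypeWith ρ (Φ i)) {i₀ i₁ : I} (hI : ∀ j, j = i₀ ∨ j = i₁) (h01 : i₀ ≠ i₁)
    (r₀ : E i₀ → Y₀) (r₁ : E i₁ → Y₁) (hr₀ : ∀ (g : G) (x : E i₀), r₀ (g • x) = g • r₀ x)
    (hr₁ : ∀ (g : G) (x : E i₁), r₁ (g • x) = g • r₁ x)
    (hfine₀ : ∀ x x' : E i₀, r₀ x = r₀ x' → ∃ n : G, (∀ y : E i₁, n • y = y) ∧ n • x = x')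
    (hfine₁ : ∀ x x' : E i₁, r₁ x = r₁ x' → ∃ n : G, (∀ y : E i₀, n • y = y) ∧ n • x = x')
    {C : Type u'} [Fintype C] {J₀ : Type u₀} {J₁ : Type u₁} [Fintype J₀] [Fintype J₁] (c₀ : J₀ → C) (c₁ : J₁ → C)
    {A₀ : J₀ → Submodule ℚ (Y₀ → ℚ)} {A₁ : J₁ → Submodule ℚ (Y₁ → ℚ)}
    (hA₀st : ∀ (j : J₀) (k : G) (a : Y₀ → ℚ), a ∈ A₀ j → (fun y => a (k • y)) ∈ A₀ j)
    (hA₀irr : ∀ (j : J₀) (W : Submodule ℚ (Y₀ → ℚ)), W ≤ A₀ j → W ≠ ⊥ →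
      (∀ (k : G) (f : Y₀ → ℚ), f ∈ W → (fun y => f (k • y)) ∈ W) → W = A₀ j)
    (hA₁st : ∀ (j : J₁) (k : G) (a : Y₁ → ℚ), a ∈ A₁ j → (fun y => a (k • y)) ∈ A₁ j)
    (hA₁irr : ∀ (j : J₁) (W : Submodule ℚ (Y₁ → ℚ)), W ≤ A₁ j → W ≠ ⊥ →
      (∀ (k : G) (f : Y₁ → ℚ), f ∈ W → (fun y => f (k • y)) ∈ W) → W = A₁ j)
    (h₀₀ : ∀ (j k : J₀) (L : (Y₀ → ℚ) →ₗ[ℚ] (Y₀ → ℚ)), c₀ j ≠ c₀ k → A₀ j ≠ ⊥ → (∀ a ∈ A₀ j, L a ∈ A₀ k) →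
      (∀ a ∈ A₀ j, L a = 0 → a = 0) → (∀ (g : G) (a : Y₀ → ℚ), a ∈ A₀ j →
        L (fun y => a (g • y)) = fun y => L a (g • y)) → False)
    (h₀₁ : ∀ (j : J₀) (k : J₁) (L : (Y₀ → ℚ) →ₗ[ℚ] (Y₁ → ℚ)), c₀ j ≠ c₁ k → A₀ j ≠ ⊥ → (∀ a ∈ A₀ j, L a ∈ A₁ k) →
      (∀ a ∈ A₀ j, L a = 0 → a = 0) → (∀ (g : G) (a : Y₀ → ℚ), a ∈ A₀ j →
        L (fun y => a (g • y)) = fun y => L a (g • y)) → False)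
    (h₁₀ : ∀ (j : J₁) (k : J₀) (L : (Y₁ → ℚ) →ₗ[ℚ] (Y₀ → ℚ)), c₁ j ≠ c₀ k → A₁ j ≠ ⊥ → (∀ a ∈ A₁ j, L a ∈ A₀ k) →
      (∀ a ∈ A₁ j, L a = 0 → a = 0) → (∀ (g : G) (a : Y₁ → ℚ), a ∈ A₁ j →
        L (fun y => a (g • y)) = fun y => L a (g • y)) → False)
    (h₁₁ : ∀ (j k : J₁) (L : (Y₁ → ℚ) →ₗ[ℚ] (Y₁ → ℚ)), c₁ j ≠ c₁ k → A₁ j ≠ ⊥ → (∀ a ∈ A₁ j, L a ∈ A₁ k) →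
      (∀ a ∈ A₁ j, L a = 0 → a = 0) → (∀ (g : G) (a : Y₁ → ℚ), a ∈ A₁ j →
        L (fun y => a (g • y)) = fun y => L a (g • y)) → False)
    {p₀ : C → (Y₀ → ℚ)} {p₁ : C → (Y₁ → ℚ)}
    (hp₀ : ∀ c, p₀ c ∈ ⨆ j : {j // c₀ j = c}, A₀ j.1) (hp₁ : ∀ c, p₁ c ∈ ⨆ j : {j // c₁ j = c}, A₁ j.1)
    (hw₀ : (fun y : Y₀ => ∑ x ∈ Finset.univ.filter (fun x => r₀ x = y), antiVec (Φ i₀) (1 : G) x) = ∑ c, p₀ c)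
    (hw₁ : (fun y : Y₁ => ∑ x ∈ Finset.univ.filter (fun x => r₁ x = y), antiVec (Φ i₁) (1 : G) x) = ∑ c, p₁ c) :
    typeRank G (Φ i₀) + typeRank G (Φ i₁) = typeRank G (sigmaType Φ) + 1 +
      ∑ c, Module.finrank ℚ ↥(Submodule.span ℚ (Set.range fun y : Y₀ => fun g : G => p₀ c (g • y)) ⊓
        Submodule.span ℚ (Set.range fun y : Y₁ => fun g : G => p₁ c (g • y))) := by
  have hpair := typeRank_add_typeRank_eq_add_finrank_shadowCoeff_inf_shadowCoeff_of_fine h hI h01 r₀ r₁ hr₀ hr₁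
    hfine₀ hfine₁
  have e₀ : (fun (y : Y₀) (g : G) => ∑ x ∈ Finset.univ.filter (fun x => r₀ x = g • y), antiVec (Φ i₀) (1 : G) x) =
      fun (y : Y₀) (g : G) => (∑ c, p₀ c) (g • y) := by
    funext y g
    exact congrFun hw₀ (g • y)
  have e₁ : (fun (y : Y₁) (g : G) => ∑ x ∈ Finset.univ.filter (fun x => r₁ x = g • y), antiVec (Φ i₁) (1 : G) x) =
      fun (y : Y₁) (g : G) => (∑ c, p₁ c) (g • y) := by
    funext y g
    exact congrFun hw₁ (g • y)
  rw [e₀, e₁, finrank_span_shadowCoeff_sum_inf_eq_sum_of_classes c₀ c₁ hA₀st hA₀irr hA₁st hA₁irr h₀₀ h₀₁ h₁₀ h₁₁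
    hp₀ hp₁] at hpair
  exact hpair

/-- **THE SAME, PRODUCING THE CLASS COMPONENTS**: if the shadows merely lie in the sums of the labelled constituents,
`w_κ ∈ Σ_j A^κ_j`, then class components `p^κ_c` exist with `w_κ = Σ_c p^κ_c` and
`rank Φ₀ + rank Φ₁ = rank(Φ₀,Φ₁) + 1 + Σ_c dim(S(p⁰_c) ∩ S(p¹_c))`. [cite: Gordon1999HodgeAVSurvey, §3 Theorem,
7.5–7.7 and 9.4.3] [cite: Serre1977, §2.6] -/
theorem exists_typeRank_add_typeRank_eq_add_sum_of_classes {ρ : G} {Φ : ∀ i, Set (E i)}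
    (h : ∀ i, IsCMTypeWith ρ (Φ i)) {i₀ i₁ : I} (hI : ∀ j, j = i₀ ∨ j = i₁) (h01 : i₀ ≠ i₁)
    (r₀ : E i₀ → Y₀) (r₁ : E i₁ → Y₁) (hr₀ : ∀ (g : G) (x : E i₀), r₀ (g • x) = g • r₀ x)
    (hr₁ : ∀ (g : G) (x : E i₁), r₁ (g • x) = g • r₁ x)
    (hfine₀ : ∀ x x' : E i₀, r₀ x = r₀ x' → ∃ n : G, (∀ y : E i₁, n • y = y) ∧ n • x = x')
    (hfine₁ : ∀ x x' : E i₁, r₁ x = r₁ x' → ∃ n : G, (∀ y : E i₀, n • y = y) ∧ n • x = x')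
    {C : Type u'} [Fintype C] {J₀ : Type u₀} {J₁ : Type u₁} [Fintype J₀] [Fintype J₁] (c₀ : J₀ → C) (c₁ : J₁ → C)
    {A₀ : J₀ → Submodule ℚ (Y₀ → ℚ)} {A₁ : J₁ → Submodule ℚ (Y₁ → ℚ)}
    (hA₀st : ∀ (j : J₀) (k : G) (a : Y₀ → ℚ), a ∈ A₀ j → (fun y => a (k • y)) ∈ A₀ j)
    (hA₀irr : ∀ (j : J₀) (W : Submodule ℚ (Y₀ → ℚ)), W ≤ A₀ j → W ≠ ⊥ →
      (∀ (k : G) (f : Y₀ → ℚ), f ∈ W → (fun y => f (k • y)) ∈ W) → W = A₀ j)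
    (hA₁st : ∀ (j : J₁) (k : G) (a : Y₁ → ℚ), a ∈ A₁ j → (fun y => a (k • y)) ∈ A₁ j)
    (hA₁irr : ∀ (j : J₁) (W : Submodule ℚ (Y₁ → ℚ)), W ≤ A₁ j → W ≠ ⊥ →
      (∀ (k : G) (f : Y₁ → ℚ), f ∈ W → (fun y => f (k • y)) ∈ W) → W = A₁ j)
    (h₀₀ : ∀ (j k : J₀) (L : (Y₀ → ℚ) →ₗ[ℚ] (Y₀ → ℚ)), c₀ j ≠ c₀ k → A₀ j ≠ ⊥ → (∀ a ∈ A₀ j, L a ∈ A₀ k) →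
      (∀ a ∈ A₀ j, L a = 0 → a = 0) → (∀ (g : G) (a : Y₀ → ℚ), a ∈ A₀ j →
        L (fun y => a (g • y)) = fun y => L a (g • y)) → False)
    (h₀₁ : ∀ (j : J₀) (k : J₁) (L : (Y₀ → ℚ) →ₗ[ℚ] (Y₁ → ℚ)), c₀ j ≠ c₁ k → A₀ j ≠ ⊥ → (∀ a ∈ A₀ j, L a ∈ A₁ k) →
      (∀ a ∈ A₀ j, L a = 0 → a = 0) → (∀ (g : G) (a : Y₀ → ℚ), a ∈ A₀ j →
        L (fun y => a (g • y)) = fun y => L a (g • y)) → False)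
    (h₁₀ : ∀ (j : J₁) (k : J₀) (L : (Y₁ → ℚ) →ₗ[ℚ] (Y₀ → ℚ)), c₁ j ≠ c₀ k → A₁ j ≠ ⊥ → (∀ a ∈ A₁ j, L a ∈ A₀ k) →
      (∀ a ∈ A₁ j, L a = 0 → a = 0) → (∀ (g : G) (a : Y₁ → ℚ), a ∈ A₁ j →
        L (fun y => a (g • y)) = fun y => L a (g • y)) → False)
    (h₁₁ : ∀ (j k : J₁) (L : (Y₁ → ℚ) →ₗ[ℚ] (Y₁ → ℚ)), c₁ j ≠ c₁ k → A₁ j ≠ ⊥ → (∀ a ∈ A₁ j, L a ∈ A₁ k) →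
      (∀ a ∈ A₁ j, L a = 0 → a = 0) → (∀ (g : G) (a : Y₁ → ℚ), a ∈ A₁ j →
        L (fun y => a (g • y)) = fun y => L a (g • y)) → False)
    (hw₀ : (fun y : Y₀ => ∑ x ∈ Finset.univ.filter (fun x => r₀ x = y), antiVec (Φ i₀) (1 : G) x) ∈ ⨆ j, A₀ j)
    (hw₁ : (fun y : Y₁ => ∑ x ∈ Finset.univ.filter (fun x => r₁ x = y), antiVec (Φ i₁) (1 : G) x) ∈ ⨆ j, A₁ j) :
    ∃ (p₀ : C → (Y₀ → ℚ)) (p₁ : C → (Y₁ → ℚ)),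
      (∀ c, p₀ c ∈ ⨆ j : {j // c₀ j = c}, A₀ j.1) ∧ (∀ c, p₁ c ∈ ⨆ j : {j // c₁ j = c}, A₁ j.1) ∧
      (fun y : Y₀ => ∑ x ∈ Finset.univ.filter (fun x => r₀ x = y), antiVec (Φ i₀) (1 : G) x) = ∑ c, p₀ c ∧
      (fun y : Y₁ => ∑ x ∈ Finset.univ.filter (fun x => r₁ x = y), antiVec (Φ i₁) (1 : G) x) = ∑ c, p₁ c ∧
      typeRank G (Φ i₀) + typeRank G (Φ i₁) = typeRank G (sigmaType Φ) + 1 +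
        ∑ c, Module.finrank ℚ ↥(Submodule.span ℚ (Set.range fun y : Y₀ => fun g : G => p₀ c (g • y)) ⊓
          Submodule.span ℚ (Set.range fun y : Y₁ => fun g : G => p₁ c (g • y))) := by
  obtain ⟨p₀, hp₀, hw₀'⟩ := exists_classComponents_of_mem_iSup c₀ hw₀
  obtain ⟨p₁, hp₁, hw₁'⟩ := exists_classComponents_of_mem_iSup c₁ hw₁
  exact ⟨p₀, p₁, hp₀, hp₁, hw₀'.symm, hw₁'.symm, typeRank_add_typeRank_eq_add_sum_of_classes h hI h01 r₀ r₁ hr₀ hr₁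
    hfine₀ hfine₁ c₀ c₁ hA₀st hA₀irr hA₁st hA₁irr h₀₀ h₀₁ h₁₀ h₁₁ hp₀ hp₁ hw₀'.symm hw₁'.symm⟩

end TypeRanks

end Summit.HodgeConjecture.CorCM.IrrOdd

end
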